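import Mathlib
import Summits.ValiantsHypothesis.ValiantsHypothesis.Theorems.ValuativeGCTValuativeFlipStrataRankL

/-!
# Sharp per-stratum rank bound, Left-multiplied strata: `4n - 20 ≤ rank` (crux `ValuativeGCT.ValuativeFlip`)

Wall-breaker axis P-explicit (explicit per-side constructions) for crux `ValuativeGCT.ValuativeFlip`
(stmt-ValiantsHypothesis-12624), line `four-row-count`; mirror of `…StrataRankRSharp`.  The landed
P4-SIMPLE bound `sl_finrank_span_ge` (`4n - 2(e+2)`, file `…StrataRankL`) loses `2e` dimensions per
stratum; here the loss is a constant: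

* `sl_finrank_span_ge_sharp` — for injective `α γ : ZMod n → K`, `n = e + k + 1`, `2 ≤ e`, `3 ≤ k`,
  the `4n` bottoms `y_t · P_{q+2o} · R_q` of the Left-multiplied stratum span at least `4n - 20`
  dimensions.

Proof (block-triangular evaluation, new).  Group the generators by their Right window `R_q` (the four
weights `c (q,·,·)`).  A relation with the groups `q = 0,…,4` switched off is trivial, by downward
induction on `q = n-1, …, 5` (`sl_step`): substitute `y₀ ↦ α_w` (`slEv`, landed) and then
`y₂ ↦ γ_{q+e}` — this kills `R_{q'}` for the `k` groups `q' ∈ [q-k, q-1]` just below `q`, while for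
the far groups `q' ∈ [5, q-k-1]` the four points `w ∈ {q+e+2, …, q+e+5}` are common roots of `P_{q'}`
and `P_{q'+2}`, so their coefficient `slA c q' w` vanishes identically; the groups above `q` vanish by
induction.  Hence `slA c q w = 0` at those four points; with the `e - 2` common roots of
`P_q, P_{q+2}` the polynomial `slPoly c q` (degree `≤ e + 1`) has `e + 2` roots, so it is zero and the
landed `sl_coeff_eq_zero_of_slPoly_eq_zero` switches group `q` off.  (Numerically the stratum rank is
`4n - 7`.) [this crux; new]
-/

set_option linter.dupNamespace false

namespace Summit.ValiantsHypothesis.ValiantsHypothesis.Theorems.ValuativeFlip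

open MvPolynomial
open scoped BigOperators

noncomputable section

section lemmas

variable {K : Type*} [Field K] {n : ℕ}

/-- Casting is injective on any window of `n` consecutive naturals: `t ≤ t' < t + n` and
`(t : ZMod n) = t'` force `t = t'`. [folklore] -/
private theorem sls_natCast_inj_of_lt {t t' : ℕ} (h1 : t ≤ t') (h2 : t' < t + n)
    (h : (t : ZMod n) = (t' : ZMod n)) : t = t' := by
  have hc : ((t' - t : ℕ) : ZMod n) = 0 := by
    rw [Nat.cast_sub h1, ← h, sub_self]
  rw [ZMod.natCast_eq_zero_iff] at hc
  rcases Nat.eq_zero_or_pos (t' - t) with h0 | hpos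
  · omega
  · have := Nat.le_of_dvd hpos hc
    omega

/-- A switched-off group contributes nothing to the coefficient of `R_q`. [this crux] -/
theorem slA_eq_zero_of_groupZero (α : ZMod n → K) (e : ℕ) {c : ZMod n × Fin 2 × Fin 2 → K}
    {q : ZMod n} (h : (c (q, 0, 0) = 0 ∧ c (q, 0, 1) = 0 ∧ c (q, 1, 0) = 0 ∧ c (q, 1, 1) = 0))
    (w : ZMod n) : slA α e c q w = 0 := by
  obtain ⟨h1, h2, h3, h4⟩ := h
  simp [slA, Fin.sum_univ_two, h1, h2, h3, h4]

/-- The value of `P_p` at `α_w` vanishes when `w = p + s`, `s < e` (a root of the window).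
[this crux] -/
theorem slPVal_eq_zero_of_eq (α : ZMod n → K) (e : ℕ) (p w : ZMod n) {s : ℕ} (hs : s < e)
    (hw : w = p + (s : ZMod n)) : slPVal α e p w = 0 := by
  unfold slPVal
  exact Finset.prod_eq_zero (Finset.mem_range.mpr hs) (by rw [hw, sub_self])

/-- **Common roots.**  At `w = q + 2 + s` with `s + 2 < e` both `P_q` and `P_{q+2}` vanish, so the
coefficient `slA c q w` of `R_q` vanishes whatever the weights are. [this crux] -/
theorem slA_eq_zero_of_common_root (α : ZMod n → K) (e : ℕ) (c : ZMod n × Fin 2 × Fin 2 → K)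
    (q w : ZMod n) {s : ℕ} (hs : s + 2 < e) (hw : w = q + 2 + (s : ZMod n)) :
    slA α e c q w = 0 := by
  unfold slA
  have h1 : slPVal α e q w = 0 := by
    refine slPVal_eq_zero_of_eq α e q w hs ?_
    rw [hw]
    push_cast
    ring
  have h2 : slPVal α e (q + 2) w = 0 := slPVal_eq_zero_of_eq α e (q + 2) w (by omega) hw
  rw [h1, h2, mul_zero, mul_zero, add_zero]

/-- **The inductive step.**  If the relation `Σ_q slA c q w • R_q = 0` holds for every `w`, and the
groups strictly above `u` and the groups `0,…,4` are switched off, then group `u` (`u < n`) is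
switched off.  Needs `α, γ` injective, `n = e + k + 1`, `2 ≤ e`, `3 ≤ k`. [this crux; new] -/
theorem sl_step [NeZero n] {α γ : ZMod n → K} (hα : Function.Injective α)
    (hγ : Function.Injective γ) {e k : ℕ} (hn : n = e + k + 1) (he : 2 ≤ e) (hk : 3 ≤ k)
    (c : ZMod n × Fin 2 × Fin 2 → K)
    (hrel : ∀ w : ZMod n, ∑ q : ZMod n,
      slA α e c q w • swW γ (2 : Fin 4) 3 k (q + ((e + 1 : ℕ) : ZMod n)) = 0)
    {u : ℕ} (hun : u < n)
    (hzero : ∀ u' : ℕ, u' < n → (u < u' ∨ u' ≤ 4) →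
      (c ((u' : ZMod n), 0, 0) = 0 ∧ c ((u' : ZMod n), 0, 1) = 0 ∧
        c ((u' : ZMod n), 1, 0) = 0 ∧ c ((u' : ZMod n), 1, 1) = 0)) :
    (c ((u : ZMod n), 0, 0) = 0 ∧ c ((u : ZMod n), 0, 1) = 0 ∧
      c ((u : ZMod n), 1, 0) = 0 ∧ c ((u : ZMod n), 1, 1) = 0) := by
  have h23 : (2 : Fin 4) ≠ 3 := by decide
  -- Step 1: the four new roots `w = u + e + 2 + i`, `i < 4`
  have hval : ∀ i : ℕ, i < 4 →
      slA α e c (u : ZMod n) ((u : ZMod n) + ((e + 2 + i : ℕ) : ZMod n)) = 0 := by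
    intro i hi
    have h := congrArg
      (MvPolynomial.eval (swPt (2 : Fin 4) (γ (((u : ZMod n) + ((e + 1 : ℕ) : ZMod n)) - 1))))
      (hrel ((u : ZMod n) + ((e + 2 + i : ℕ) : ZMod n)))
    rw [map_sum, map_zero, Finset.sum_eq_single (u : ZMod n)] at h
    · rw [smul_eval] at h
      exact (mul_eq_zero.mp h).resolve_right (sw_eval_pt_ne_zero hγ h23 (by omega) _)
    · intro q _ hq
      rw [smul_eval]
      obtain ⟨u', hu'n, rfl⟩ : ∃ u' : ℕ, u' < n ∧ q = (u' : ZMod n) :=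
        ⟨q.val, ZMod.val_lt q, (ZMod.natCast_zmod_val q).symm⟩
      have hne : u' ≠ u := by
        intro h'
        exact hq (by rw [h'])
      rcases (show (u < u' ∨ u' ≤ 4) ∨ (u' < u ∧ 5 ≤ u') by omega) with hA | ⟨hlt, h5⟩
      · rw [slA_eq_zero_of_groupZero α e (hzero u' hu'n hA), zero_mul]
      · rcases Nat.lt_or_ge (u' + k) u with hfar | hnear
        · -- far group: `u + e + 2 + i` is a common root of `P_{u'}` and `P_{u'+2}`
          obtain ⟨s, hs1, hs2⟩ : ∃ s : ℕ, u + (e + 2 + i) = u' + 2 + s + n ∧ s + 2 < e :=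
            ⟨u + (e + 2 + i) - u' - 2 - n, by omega, by omega⟩
          rw [slA_eq_zero_of_common_root α e c _ _ hs2 ?_, zero_mul]
          have hc := congrArg (Nat.cast : ℕ → ZMod n) hs1
          push_cast at hc
          rw [ZMod.natCast_self, add_zero] at hc
          push_cast
          exact hc
        · -- near group: `R_{u'}` vanishes at `γ_{u+e}`
          obtain ⟨d, hd1, hd2⟩ : ∃ d : ℕ, u = u' + d + 1 ∧ d < k := ⟨u - 1 - u', by omega, by omega⟩
          rw [sw_eval_pt_eq_zero γ h23 ((u' : ZMod n) + ((e + 1 : ℕ) : ZMod n))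
            (((u : ZMod n) + ((e + 1 : ℕ) : ZMod n)) - 1) hd2 ?_, mul_zero]
          rw [hd1]
          push_cast
          ring
    · intro h'
      exact absurd (Finset.mem_univ _) h'
  -- Step 2: the `e - 2` common roots of `P_u` and `P_{u+2}`
  have hcommon : ∀ s : ℕ, s + 2 < e →
      slA α e c (u : ZMod n) ((u : ZMod n) + ((2 + s : ℕ) : ZMod n)) = 0 := by
    intro s hs
    refine slA_eq_zero_of_common_root α e c _ _ hs ?_
    push_cast
    ring
  -- Step 3: `slPoly c u` has `e + 2` distinct roots
  let off : Fin (e + 2) → ℕ := fun j => if (j : ℕ) < 4 then e + 2 + (j : ℕ) else 2 + ((j : ℕ) - 4)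
  have hoff_bd : ∀ j, 2 ≤ off j ∧ off j ≤ e + 5 := by
    intro j
    have hj := j.isLt
    simp only [off]
    split_ifs <;> omega
  have hoff_inj : ∀ j j' : Fin (e + 2), off j = off j' → j = j' := by
    intro j j' h
    apply Fin.ext
    simp only [off] at h
    split_ifs at h <;> omega
  let pts : Fin (e + 2) → K := fun j => α ((u : ZMod n) + ((off j : ℕ) : ZMod n))
  have hpts : Function.Injective pts := by
    intro j j' h
    have h1 : (u : ZMod n) + ((off j : ℕ) : ZMod n) = (u : ZMod n) + ((off j' : ℕ) : ZMod n) := hα h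
    have h2 : ((off j : ℕ) : ZMod n) = ((off j' : ℕ) : ZMod n) := add_left_cancel h1
    have bj := hoff_bd j
    have bj' := hoff_bd j'
    rcases le_total (off j) (off j') with hle | hle
    · exact hoff_inj j j' (sls_natCast_inj_of_lt hle (by omega) h2)
    · exact (hoff_inj j' j (sls_natCast_inj_of_lt hle (by omega) h2.symm)).symm
  have hroots : ∀ j, (slPoly α e c (u : ZMod n)).eval (pts j) = 0 := by
    intro j
    have hj := j.isLt
    change (slPoly α e c (u : ZMod n)).eval (α ((u : ZMod n) + ((off j : ℕ) : ZMod n))) = 0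
    rw [eval_slPoly]
    by_cases hj4 : (j : ℕ) < 4
    · simp only [off, if_pos hj4]
      exact hval j hj4
    · simp only [off, if_neg hj4]
      exact hcommon ((j : ℕ) - 4) (by omega)
  have hpoly : slPoly α e c (u : ZMod n) = 0 :=
    Polynomial.eq_zero_of_natDegree_lt_card_of_eval_eq_zero _ hpts hroots
      (by simpa only [Fintype.card_fin] using Nat.lt_succ_of_le (natDegree_slPoly_le α e c _))
  exact sl_coeff_eq_zero_of_slPoly_eq_zero hα hn he (by omega) c _ hpoly

/-- **All groups vanish** once the groups `0, …, 4` are switched off (downward induction on the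
group index with `sl_step`). [this crux; new] -/
theorem sl_allGroups_zero [NeZero n] {α γ : ZMod n → K} (hα : Function.Injective α)
    (hγ : Function.Injective γ) {e k : ℕ} (hn : n = e + k + 1) (he : 2 ≤ e) (hk : 3 ≤ k)
    (c : ZMod n × Fin 2 × Fin 2 → K)
    (hrel : ∀ w : ZMod n, ∑ q : ZMod n,
      slA α e c q w • swW γ (2 : Fin 4) 3 k (q + ((e + 1 : ℕ) : ZMod n)) = 0)
    (hbase : ∀ u : ℕ, u ≤ 4 →
      (c ((u : ZMod n), 0, 0) = 0 ∧ c ((u : ZMod n), 0, 1) = 0 ∧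
        c ((u : ZMod n), 1, 0) = 0 ∧ c ((u : ZMod n), 1, 1) = 0)) :
    ∀ u : ℕ, u < n →
      (c ((u : ZMod n), 0, 0) = 0 ∧ c ((u : ZMod n), 0, 1) = 0 ∧
        c ((u : ZMod n), 1, 0) = 0 ∧ c ((u : ZMod n), 1, 1) = 0) := by
  suffices h : ∀ d u : ℕ, u + d + 1 = n →
      (c ((u : ZMod n), 0, 0) = 0 ∧ c ((u : ZMod n), 0, 1) = 0 ∧
        c ((u : ZMod n), 1, 0) = 0 ∧ c ((u : ZMod n), 1, 1) = 0) by
    intro u hu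
    exact h (n - 1 - u) u (by omega)
  intro d
  induction' d using Nat.strong_induction_on with d ih
  intro u hud
  by_cases hu4 : u ≤ 4
  · exact hbase u hu4
  · refine sl_step hα hγ hn he hk c hrel (by omega) ?_
    intro u' hu'n hcase
    rcases hcase with hlt | hle
    · exact ih (n - 1 - u') (by omega) u' (by omega)
    · exact hbase u' hle

end lemmas

/-- **P4 SHARP, Left side.**  For injective `α γ : ZMod n → K`, `n = e + k + 1`, `2 ≤ e`, `3 ≤ k`:
the `4n` products `y_t · P_{q+2o} · R_q` span at least `4n - 20` dimensions (the kernel of the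
coefficient map embeds into the `20` weights of the groups `0, …, 4`). [this crux; new] -/
theorem sl_finrank_span_ge_sharp {K : Type*} [Field K] {n : ℕ} [NeZero n] {α γ : ZMod n → K}
    (hα : Function.Injective α) (hγ : Function.Injective γ) {e k : ℕ} (hn : n = e + k + 1)
    (he : 2 ≤ e) (hk : 3 ≤ k) :
    4 * n - 20 ≤ Module.finrank K ↥(Submodule.span K (Set.range (slGen α γ e k))) := by
  classical
  set Ψ := Fintype.linearCombination K (slGen α γ e k) with hΨ
  have hrange : LinearMap.range Ψ = Submodule.span K (Set.range (slGen α γ e k)) :=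
    Fintype.range_linearCombination K _
  -- the recording map on the kernel: the weights of the groups `0, …, 4`
  let Θ : (LinearMap.ker Ψ) →ₗ[K] (Fin 5 × Fin 2 × Fin 2 → K) :=
    { toFun := fun c j => (c : ZMod n × Fin 2 × Fin 2 → K) (((j.1 : ℕ) : ZMod n), j.2.1, j.2.2)
      map_add' := by
        intro c d; funext j
        simp only [Submodule.coe_add, Pi.add_apply]
      map_smul' := by
        intro r c; funext j
        simp only [Submodule.coe_smul, Pi.smul_apply, smul_eq_mul, RingHom.id_apply] }
  have hΘ : Function.Injective Θ := by
    rw [← LinearMap.ker_eq_bot, LinearMap.ker_eq_bot']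
    intro c hc
    obtain ⟨c, hcker⟩ := c
    have hrel : Ψ c = 0 := hcker
    have hrelR : ∀ w : ZMod n, ∑ q : ZMod n,
        slA α e c q w • swW γ (2 : Fin 4) 3 k (q + ((e + 1 : ℕ) : ZMod n)) = 0 := by
      intro w
      rw [← slEv_linearCombination α γ e k w c]
      change slEv α w (Ψ c) = 0
      rw [hrel, map_zero]
    have hbase : ∀ u : ℕ, u ≤ 4 →
        (c ((u : ZMod n), 0, 0) = 0 ∧ c ((u : ZMod n), 0, 1) = 0 ∧
          c ((u : ZMod n), 1, 0) = 0 ∧ c ((u : ZMod n), 1, 1) = 0) := by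
      intro u hu
      have h0 : ∀ o t : Fin 2, c ((u : ZMod n), o, t) = 0 := by
        intro o t
        have := congrFun hc ((⟨u, by omega⟩ : Fin 5), o, t)
        simpa [Θ] using this
      exact ⟨h0 0 0, h0 0 1, h0 1 0, h0 1 1⟩
    have hall := sl_allGroups_zero hα hγ hn he hk c hrelR hbase
    apply Subtype.ext
    funext ⟨q, o, t⟩
    simp only [Submodule.coe_zero, Pi.zero_apply]
    have h := hall q.val (ZMod.val_lt q)
    simp only [ZMod.natCast_zmod_val] at h
    obtain ⟨h1, h2, h3, h4⟩ := h
    fin_cases o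
    · fin_cases t
      · exact h1
      · exact h2
    · fin_cases t
      · exact h3
      · exact h4
  -- dimension count
  have hker : Module.finrank K (LinearMap.ker Ψ) ≤ 20 := by
    have := LinearMap.finrank_le_finrank_of_injective hΘ
    rw [Module.finrank_fintype_fun_eq_card, Fintype.card_prod, Fintype.card_prod, Fintype.card_fin,
      Fintype.card_fin] at this
    linarith
  have hrn := LinearMap.finrank_range_add_finrank_ker Ψ
  rw [Module.finrank_fintype_fun_eq_card, Fintype.card_prod, Fintype.card_prod, ZMod.card,
    Fintype.card_fin] at hrn
  rw [← hrange]
  omega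

end

end Summit.ValiantsHypothesis.ValiantsHypothesis.Theorems.ValuativeFlip
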